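import Literature.MathematicalPhysics.QuantumFieldTheory.Balaban1983to89.Node00.Record12BgRowCoClassGaugeRGuardedBRow
import Literature.MathematicalPhysics.QuantumFieldTheory.Balaban1983to89.Node00.LargeFieldBackgroundCoPOfRecordB

/-!
# NODE 00 — ROW P11's BODY AT node00-def-R's PRINT-DATUM BACKGROUND `UbgMSCoPOfRecordB … s 𝐖` (S2b) ON THE [II] (2.3) FIBRE `lamDatum F` = `lamBondsSeq`: the record-level accessors, the
# `CoP` row and the Stage-13 lift — the instances of `Record12BgRowCoClassGaugeRGuardedBRow` at `(bd, Ubg) := (lamDatum F, UbgMSCoPOfRecordB)`, any `Dat` (breaker-free imports)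

Cell `pub-ymgap`, seat `pub-ymgap-k0-s1-w1` g9 (K0⁷ **stmt-QuantumFields-20541** helper lane; (E1)∕(iii-b) WORKPLAN-IIIB 27c850bec22d4efe; director-ym №338 ∕ №339 (α) ∕ №343 (D1)–(D6): after
the Stage-2 seam edit `UbgOfRecord₁₃CoP (n+1) := UbgMSCoPOfRecordB …` the coherence TRAIN re-keys the 22 direct users IN PLACE — linchpin `Record13SepCoPInhabitedOfClassC1`, `…OfThm1CoP7M(C1)`,
`…OfThm1CoPGauge`, CCM(W) GaugeR ×3, `Thm/…K0AllTorusOfStepTokensGuarded(ZB)` … — and every one of them re-keys onto the names below; node00-def-R S2-DESIGN-1 ∕ S2-BLAST-RADIUS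
4d280396c569eac5: «K0 ×4 ≈ 1–2 h each per k0-s1-w1: instantiate `Ubg := UbgMSCoPOfRecordB`, discharge `hbg` by the S2b dichotomy»).  `--kind proof --supports stmt-QuantumFields-20541`
(count-neutral).  THEOREMS ONLY (0 `def`, 0 `sorry`).  [15] = [Balaban1985Variational]; [II] = [Balaban1984PropagatorsII]; [III] = [Balaban1988Convergent]; [I] = [Balaban1987RG1].

HONESTY GUARD (№338 (5)).  PURELY ADDITIVE instances; the (b)-instance rows about `UbgMSCoPOfRecord` (`Record12BgRowCoClassCPMFloor` §2, `…GaugeRGuarded` §3∕§5, `Thm/…K0AllTorusOfStepTokensGuarded`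
§1) stay landed and true on their own text; nothing edited.  `lamDatum F K k Ω = lamBondsSeq Ω k` is `rfl` (F0c `lamDatum_apply`), so S2b's spec family — stated over `lamBondsSeq s.Ω k` — IS the
`bd := lamDatum F` instance of the `(bd, Dat, Ubg)` rows, definitionally.

WHAT IS PROVED (each a one-line instantiation).
* §1 the record-level ACCESSORS the linchpin ∕ `…OfThm1CoP7M(C1)` re-keys read: `plaqSmallOn_UbgMSCoPOfRecordB_of_thm1RegSepCoP7MGB`, `coDivSmallOn_UbgMSCoPOfRecordB_of_thm1RegSepCoP7MGB`
  (S1a-C's `plaqSmallOn ∕ coDivSmallOn_of_thm1RegSepTop7MGB` at `h15 : VariationalThm1RegSepCoP7MGB F N Adm (lamDatum F) Dat …` ∘ S2b `isMinimizerB_UbgMSCoPOfRecordB`, on the solvable set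
  `solvableDomB … (lamBondsSeq s.Ω k)`), `localGaugeOn_UbgMSCoPOfRecordB_of_thm1GaugeRegSepCoP7MGB` (S1b-2's `localGaugeOn_of_thm1GaugeRegSepTop7MGB` likewise).
* §2 ★★★ `bgRowAtDatumCoPB_of_thm1RegSepCoP7MGB_of_thm1GaugeGB` — row P11 at `UbgMSCoPOfRecordB … s 𝐖`, every `𝐖` (S1b-3 §2 ∘ S2b `ubgMSCoPOfRecordB_dichotomy`).
* §3 ★ `Stage13Params.bgAtDatumCoPB_of_thm1RegSepCoP7MGB_of_thm1GaugeGB` (the Stage-13 lift at `UbgMSCoPOfRecordB`, `hsN` displayed) — the statement TRAIN-K0's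
  `Thm/…K0AllTorusOfStepTokensGuarded(ZB)` re-keys onto by name.  (The whole-torus edition with `hsN` discharged by `PartCompat₁₃` is the separate leaf `…GaugeRGuardedBRowAllTorusLam`:
  its `hsN` supplier `Stage13Params.hsN_of_partCompat₁₃` lives in a Stage-2 coherence-train module, and THIS file is kept free of every such import so that it stays buildable
  through the seam edit — import-closure census k0-s1-w1 g9, 2026-08-30.)
HONEST SCOPE.  Instantiation bookkeeping; nothing of [15] ∕ [III] asserted or discharged; `stub_prop8StepCoPGridG13` ∕ K0⁷ NOT closed; N07 NOT discharged; counts unmoved (typed 28∕28 · discharged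
8∕28); one finite `𝕋⁴` family at fixed `ε` — the route closes the conditional finite-𝕋⁴ rung `BalabanLadder.UV` only; NOT continuum ∕ ℝ⁴ ∕ OS; the Yang–Mills mass gap (Clay) is NOT proved.
No `def`, no `instance`, no `notation`, no `sorry`.

References: [15] (6)–(7) p.278, Thm 1 (8)–(9) p.279, Prop. 8 p.304, p.304 lines 1–2; [II] (2.3) p.224; [III] Thm 1 p.262, (2.1) p.254, (2.12)–(2.13) p.256, (2.27)–(2.28) p.259,
(2.34)–(2.41) p.261; [I] (0.1) p.251, (1.11)–(1.12) p.262.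
-/

noncomputable section

open MeasureTheory
open scoped Matrix.Norms.L2Operator

namespace Literature.MathematicalPhysics.QuantumFieldTheory.Balaban1983to89.Node00

open T4Continuum B14.Eq218Concrete B15DeterminingSets B15DeterminingSetsB B12RegularSpaces111 B14RegularSpaces234 B14Radii

/-! ## §1  The record-level accessors at `UbgMSCoPOfRecordB` on the solvable set -/

section AccessorsLam

variable {F : T4Family} {N : ℕ} [NeZero N]

/-- **node00-def-R's PRINT-DATUM BACKGROUND `UbgMSCoPOfRecordB … s 𝐖` IS `B₃·cR·ε_n`-REGULAR ON THE SOLVABLE SET, AT A PREFIX PASSING THE GUARD** (plaquette half) — `Record12BgRowCoClassCPMFloor`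
§2's `plaqSmallOn_UbgMSCoPOfRecord_of_thm1RegSepCoP7MR` over `(lamDatum F, Dat)` at the B background: S1a-C's accessor ∘ S2b's spec. [cite: Balaban1985Variational, Thm 1 (2),(6)–(8) pp.278–279; Balaban1984PropagatorsII, (2.3) p.224; Balaban1988Convergent, (2.12)–(2.13) p.256] -/
theorem plaqSmallOn_UbgMSCoPOfRecordB_of_thm1RegSepCoP7MGB {Adm : StepGuard F} {Dat : TopData F N} {B₃ a₀ a₁ : ℝ} (h15 : VariationalThm1RegSepCoP7MGB F N Adm (lamDatum F) Dat B₃ a₀ a₁)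
    (ν : Stage7Numerics) (M : ℕ) (g : ℕ → ℝ) (K k : ℕ) (cR : ℝ) (s : SeqOfRecord F ν M g K k) (hsep : Sect2.SeqSeparated ν.M₁ s) (hM₁ : 0 < ν.M₁) (hadm : Adm ν M g K k s)
    (hnum : ∀ n, n ≤ k → 0 < cR * epsOfRecord ν g n ∧ cR * epsOfRecord ν g n ≤ a₁ ∧ B₃ * (cR * epsOfRecord ν g n) ≤ ν.εreg) (ha₀ : ν.εreg ≤ a₀)
    (hcomp : ∀ n, n < k → cR * epsOfRecord ν g n ≤ 2 * (cR * epsOfRecord ν g (n + 1)))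
    (hcomp' : ∀ n, n < k → cR * epsOfRecord ν g (n + 1) ≤ 2 * (cR * epsOfRecord ν g n))
    {W : MSField (F.P K) (SU N)} (h7 : Dat K s.Ω (suppDomOfRecord F ν K s.Ω) k (fun n => cR * epsOfRecord ν g n) W)
    (hsol : W ∈ solvableDomB (avOfRecord F N K) (regMSCoPOfRecord F N ν K k s.Ω) (lamBondsSeq s.Ω k)) :
    ∀ n, n ≤ k → PlaqSmallOn (Sect2.omegaPlaqsTop s.Ω (suppDomOfRecord F ν K s.Ω) n) (B₃ * (cR * epsOfRecord ν g n) * (F.P K).eta n ^ 2) (UbgMSCoPOfRecordB F N ν M g K k s W) :=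
  plaqSmallOn_of_thm1RegSepTop7MGB h15 ν M g K k cR s hsep hM₁ hadm hnum ha₀ hcomp hcomp' h7 (isMinimizerB_UbgMSCoPOfRecordB ν M g K k s hsol)

/-- The co-divergence half at `UbgMSCoPOfRecordB` on the solvable set. [cite: Balaban1985Variational, Thm 1 (8) p.279; Balaban1985RegularSpaces, (1.9) p.77; Balaban1984PropagatorsII, (2.3) p.224] -/
theorem coDivSmallOn_UbgMSCoPOfRecordB_of_thm1RegSepCoP7MGB {Adm : StepGuard F} {Dat : TopData F N} {B₃ a₀ a₁ : ℝ} (h15 : VariationalThm1RegSepCoP7MGB F N Adm (lamDatum F) Dat B₃ a₀ a₁)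
    (ν : Stage7Numerics) (M : ℕ) (g : ℕ → ℝ) (K k : ℕ) (cR : ℝ) (s : SeqOfRecord F ν M g K k) (hsep : Sect2.SeqSeparated ν.M₁ s) (hM₁ : 0 < ν.M₁) (hadm : Adm ν M g K k s)
    (hnum : ∀ n, n ≤ k → 0 < cR * epsOfRecord ν g n ∧ cR * epsOfRecord ν g n ≤ a₁ ∧ B₃ * (cR * epsOfRecord ν g n) ≤ ν.εreg) (ha₀ : ν.εreg ≤ a₀)
    (hcomp : ∀ n, n < k → cR * epsOfRecord ν g n ≤ 2 * (cR * epsOfRecord ν g (n + 1)))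
    (hcomp' : ∀ n, n < k → cR * epsOfRecord ν g (n + 1) ≤ 2 * (cR * epsOfRecord ν g n))
    {W : MSField (F.P K) (SU N)} (h7 : Dat K s.Ω (suppDomOfRecord F ν K s.Ω) k (fun n => cR * epsOfRecord ν g n) W)
    (hsol : W ∈ solvableDomB (avOfRecord F N K) (regMSCoPOfRecord F N ν K k s.Ω) (lamBondsSeq s.Ω k)) :
    ∀ n, n ≤ k → Sect2.CoDivSmallOn (Sect2.omegaBondsTop s.Ω (suppDomOfRecord F ν K s.Ω) n) (B₃ * (cR * epsOfRecord ν g n) * (F.P K).eta n ^ 3) (UbgMSCoPOfRecordB F N ν M g K k s W) :=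
  coDivSmallOn_of_thm1RegSepTop7MGB h15 ν M g K k cR s hsep hM₁ hadm hnum ha₀ hcomp hcomp' h7 (isMinimizerB_UbgMSCoPOfRecordB ν M g K k s hsol)

/-- **`UbgMSCoPOfRecordB … s 𝐖` CARRIES THE LOCAL GAUGES OF (9) LINE 1 ON BOTH CUBE FAMILIES INSIDE `Ω_n`, `1 ≤ n ≤ k`, ON THE SOLVABLE SET** — `Record12BgRowCoClassGaugeRGuarded` §3's
`localGaugeOn_UbgMSCoPOfRecord_of_thm1GaugeRegSepCoP7MG` over `(lamDatum F, Dat)` at the B background: S1b-2's accessor ∘ S2b's spec.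
[cite: Balaban1985Variational, Thm 1 (2),(6),(7),(9) pp.278–279; Balaban1984PropagatorsII, (2.3) p.224; Balaban1988Convergent, (2.12)–(2.13) p.256, (2.38) p.261; Balaban1987RG1, (0.1) p.251] -/
theorem localGaugeOn_UbgMSCoPOfRecordB_of_thm1GaugeRegSepCoP7MGB {M : ℕ} {Adm : StepGuard F} {Dat : TopData F N} {B₃ B₃' a₀ a₁ : ℝ}
    (h15G : VariationalThm1GaugeRegSepCoP7MGB F N M Adm (lamDatum F) Dat B₃ B₃' a₀ a₁)
    (ν : Stage7Numerics) (g : ℕ → ℝ) (K k : ℕ) (cR : ℝ) (s : SeqOfRecord F ν M g K k) (hsep : Sect2.SeqSeparated ν.M₁ s) (hM₁ : 0 < ν.M₁) (hadm : Adm ν M g K k s)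
    (hnum : ∀ n, n ≤ k → 0 < cR * epsOfRecord ν g n ∧ cR * epsOfRecord ν g n ≤ a₁ ∧ B₃ * (cR * epsOfRecord ν g n) ≤ ν.εreg) (ha₀ : ν.εreg ≤ a₀)
    (hcomp : ∀ n, n < k → cR * epsOfRecord ν g n ≤ 2 * (cR * epsOfRecord ν g (n + 1)))
    (hcomp' : ∀ n, n < k → cR * epsOfRecord ν g (n + 1) ≤ 2 * (cR * epsOfRecord ν g n))
    {W : MSField (F.P K) (SU N)} (h7 : Dat K s.Ω (suppDomOfRecord F ν K s.Ω) k (fun n => cR * epsOfRecord ν g n) W)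
    (hsol : W ∈ solvableDomB (avOfRecord F N K) (regMSCoPOfRecord F N ν K k s.Ω) (lamBondsSeq s.Ω k)) :
    ∀ n, 1 ≤ n → n ≤ k →
      (((B14.Eq213MaximalDomains.side (F.P K).L M n : ℕ) : ℤ) < (F.P K).sitesPerDir 0 →
        ∀ a ∈ cubeIndices (F.P K) (B14.Eq213MaximalDomains.side (F.P K).L M n),
          cubeEnl (F.P K) (B14.Eq213MaximalDomains.side (F.P K).L M n) a 0 ⊆ s.Ω n →
          Sect2.LocalGaugeOn (cubeEnl (F.P K) (B14.Eq213MaximalDomains.side (F.P K).L M n) a 0) ((F.P K).eta n) (B₃' * (cR * epsOfRecord ν g n))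
            (UbgMSCoPOfRecordB F N ν M g K k s W)) ∧
      (((B14.Eq213MaximalDomains.side (F.P K).L M (n + 1) : ℕ) : ℤ) < (F.P K).sitesPerDir 0 →
        ∀ a ∈ cubeIndices (F.P K) (B14.Eq213MaximalDomains.side (F.P K).L M (n + 1)),
          cubeEnl (F.P K) (B14.Eq213MaximalDomains.side (F.P K).L M (n + 1)) a 0 ⊆ s.Ω n →
          Sect2.LocalGaugeOn (cubeEnl (F.P K) (B14.Eq213MaximalDomains.side (F.P K).L M (n + 1)) a 0) ((F.P K).eta n) (B₃' * (cR * epsOfRecord ν g n))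
            (UbgMSCoPOfRecordB F N ν M g K k s W)) :=
  localGaugeOn_of_thm1GaugeRegSepTop7MGB h15G ν g K k cR s hsep hM₁ hadm hnum ha₀ hcomp hcomp' h7 (isMinimizerB_UbgMSCoPOfRecordB ν M g K k s hsol)

end AccessorsLam

/-! ## §2  Row P11 at `UbgMSCoPOfRecordB … s 𝐖`, every `𝐖` -/

section RowLam

variable {F : T4Family} {N : ℕ} [NeZero N]

/-- **★★★ ROW P11's BODY AT `(s, 𝐖)` FOR node00-def-R's PRINT-DATUM BACKGROUND `UbgMSCoPOfRecordB … s 𝐖`, FROM THE GUARDED (8) `CoP` SENTENCE `VariationalThm1RegSepCoP7MGB … Adm (lamDatum F) Dat …`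
AND THE GUARDED GAUGE `CoP` SENTENCE `VariationalThm1GaugeRegSepCoP7MGB … M Adm (lamDatum F) Dat …`, AT A PREFIX PASSING THE GUARD** — S1b-3 §2 `bgRowAtDatumBg_…` at `U := UbgMSCoPOfRecordB … s W`
with the dichotomy discharged by S2b `ubgMSCoPOfRecordB_dichotomy` (minimiser on the solvable set, junk `1` off it).  The statement the linchpin-side re-keys of `…OfThm1CoPGauge` cite by name.
[cite: Balaban1985Variational, Thm 1 (2),(6)–(9) pp.278–279, p.304 lines 1–2; Balaban1984PropagatorsII, (2.3) p.224; Balaban1988Convergent, (2.6)–(2.8) pp.255–256, (2.12)–(2.13) p.256, (2.27)–(2.28) p.259, (2.34)–(2.41) p.261; Balaban1987RG1, (0.1) p.251, (1.11)–(1.16) p.262] -/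
theorem bgRowAtDatumCoPB_of_thm1RegSepCoP7MGB_of_thm1GaugeGB {M : ℕ} {Adm : StepGuard F} {Dat : TopData F N} {B₃ B₃' a₀ a₁ : ℝ}
    (h15 : VariationalThm1RegSepCoP7MGB F N Adm (lamDatum F) Dat B₃ a₀ a₁) (h15G : VariationalThm1GaugeRegSepCoP7MGB F N M Adm (lamDatum F) Dat B₃ B₃' a₀ a₁)
    (S : Sect2.Setting (MatA N) (SU N)) (hι : S.ι = ιSU N) (h𝓜 : S.𝓜 = B12RegularSpaces111SpecialUnitary.suModel N) (hS : S.Laws) (hpos : S.Pos)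
    (ν : Stage7Numerics) (hM : 0 < M) (K k : ℕ) (cR : ℝ)
    (hnum : ∀ n, n ≤ k → 0 < cR * epsOfRecord ν S.flow.g n ∧ cR * epsOfRecord ν S.flow.g n ≤ a₁ ∧ B₃ * (cR * epsOfRecord ν S.flow.g n) ≤ ν.εreg)
    (ha₀ : ν.εreg ≤ a₀) (hcomp : ∀ n, n < k → cR * epsOfRecord ν S.flow.g n ≤ 2 * (cR * epsOfRecord ν S.flow.g (n + 1)))
    (hcomp' : ∀ n, n < k → cR * epsOfRecord ν S.flow.g (n + 1) ≤ 2 * (cR * epsOfRecord ν S.flow.g n))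
    (hα : ∀ n, 1 ≤ n → n ≤ k → 0 < S.lf.alpha0 (S.flow.g n) ∧ 0 < S.lf.alpha1 (S.flow.g n))
    (hBα : ∀ n, 1 ≤ n → n ≤ k → B₃ * (cR * epsOfRecord ν S.flow.g n) ≤ (1 - S.βc) * S.lf.alpha0 (S.flow.g n))
    (htI : ∀ n, 1 ≤ n → n ≤ k → B₃' * (cR * epsOfRecord ν S.flow.g n) ≤ S.cB * S.lf.alpha0 (S.flow.g n))
    (htMS : ∀ n, 1 ≤ n → n ≤ k → B₃' * (cR * epsOfRecord ν S.flow.g n) ≤ S.B * S.C * S.Mr * S.lf.alpha0 (S.flow.g n))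
    (hC1 : ∀ j, 1 ≤ j → j ≤ k → ∃ t : ℕ, 0 < t ∧ RkOfRecord (F.P K).L ν.r (S.flow.g j) = (F.P K).L * t)
    (hC2 : ∀ j, 1 ≤ j → j ≤ k → dCubeSide (F.P K).L M (RkOfRecord (F.P K).L ν.r (S.flow.g j)) j ∣ (F.P K).sitesPerDir 0)
    (hsN : ∀ n, 1 ≤ n → n ≤ k + 1 → ((B14.Eq213MaximalDomains.side (F.P K).L M n : ℕ) : ℤ) < (F.P K).sitesPerDir 0)
    (s : SeqOfRecord F ν M S.flow.g K k) (hsep : Sect2.SeqSeparated ν.M₁ s) (hM₁ : 0 < ν.M₁) (hadm : Adm ν M S.flow.g K k s) (W : MSField (F.P K) (SU N))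
    (h7 : Dat K s.Ω (suppDomOfRecord F ν K s.Ω) k (fun n => cR * epsOfRecord ν S.flow.g n) W) :
    ∀ j, 1 ≤ j → j ≤ k → ∀ X : (Sect2.domSys (F.P K) M j).Dom,
      (Sect2.domSites (F.P K) M j X ⊆ s.Λ j →
        Sect2.ofBackgroundC S.ι (UbgMSCoPOfRecordB F N ν M S.flow.g K k s W) ∈
          Sect2.spaceI S (Sect2.Residual.unit (F.P K) (MatA N)) M j (Sect2.domSites (F.P K) M j X) (S.lf.alpha0 (S.flow.g j)) (S.lf.alpha1 (S.flow.g j))) ∧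
      (Sect2.admB (F.P K) ν M S.flow.g s.Ω s.Λ j (Sect2.domSites (F.P K) M j X) = true →
        Sect2.ofBackgroundC S.ι (UbgMSCoPOfRecordB F N ν M S.flow.g K k s W) ∈
          Sect2.spaceMS S (Sect2.Residual.unit (F.P K) (MatA N)) M j (Sect2.domSites (F.P K) M j X) s.Ω) :=
  bgRowAtDatumBg_of_thm1RegSepCoP7MGB_of_thm1GaugeGB h15 h15G S hι h𝓜 hS hpos ν hM K k cR hnum ha₀ hcomp hcomp' hα hBα htI htMS hC1 hC2 hsN s hsep hM₁ hadm W h7 _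
    (ubgMSCoPOfRecordB_dichotomy ν M S.flow.g K k s W)

end RowLam

/-! ## §3  The Stage-13 lift at `UbgMSCoPOfRecordB` (the statement TRAIN-K0 re-keys `Thm/…K0AllTorusOfStepTokensGuarded(ZB)` §1 onto) -/

section LiftLam

variable {F : T4Family} {N : ℕ} [NeZero N]

/-- **★ ROW P11 AT `UbgMSCoPOfRecordB … n s 𝐖` AT THE STAGE-13 RECORD, GUARD AS INNER ANTECEDENT** — S1b-3 §3 `Stage13Params.bgAtDatumBg_…` at `Ubg := UbgMSCoPOfRecordB …`, `bd := lamDatum F`,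
`hbg := ubgMSCoPOfRecordB_dichotomy`; any `Dat`.  The `(lamDatum)`-road twin of `Record12BgRowCoClassGaugeRGuarded` §5. [cite: Balaban1985Variational, (6)–(7) p.278, Thm 1 (8)–(9) p.279, Prop. 8 p.304, p.304 lines 1–2; Balaban1984PropagatorsII, (2.3) p.224; Balaban1988Convergent, Thm 1 p.262, (2.4)–(2.8) pp.255–256, (2.12)–(2.13) p.256, (2.27)–(2.28) p.259, (2.34)–(2.41) p.261; Balaban1987RG1, (0.1) p.251, (1.11)–(1.12) p.262] -/
theorem Stage13Params.bgAtDatumCoPB_of_thm1RegSepCoP7MGB_of_thm1GaugeGB (θ : Stage13Params F N) (hθ : θ.Admissible F N) (hRz : θ.Rz = RzOfRecord F N)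
    {Adm : StepGuard F} {Dat : TopData F N} {B₃ B₃' a₀ a₁ : ℝ} (hM : 0 < θ.τ9.M)
    (h15 : VariationalThm1RegSepCoP7MGB F N Adm (lamDatum F) Dat B₃ a₀ a₁) (h15G : VariationalThm1GaugeRegSepCoP7MGB F N θ.τ9.M Adm (lamDatum F) Dat B₃ B₃' a₀ a₁)
    (hnum : ∀ (p : B12.RunParams) (n : ℕ), n ≤ p.K → Step.InInterval θ.γ n (gOfRecord₁₃ F N θ p) → ∀ m, m ≤ n →
      0 < θ.s2.cR * epsOfRecord θ.ν (gOfRecord₁₃ F N θ p) m ∧ θ.s2.cR * epsOfRecord θ.ν (gOfRecord₁₃ F N θ p) m ≤ a₁ ∧ B₃ * (θ.s2.cR * epsOfRecord θ.ν (gOfRecord₁₃ F N θ p) m) ≤ θ.ν.εreg)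
    (ha₀ : θ.ν.εreg ≤ a₀)
    (hcomp : ∀ (p : B12.RunParams) (n : ℕ), n ≤ p.K → Step.InInterval θ.γ n (gOfRecord₁₃ F N θ p) → ∀ m, m < n →
      θ.s2.cR * epsOfRecord θ.ν (gOfRecord₁₃ F N θ p) m ≤ 2 * (θ.s2.cR * epsOfRecord θ.ν (gOfRecord₁₃ F N θ p) (m + 1)))
    (hcomp' : ∀ (p : B12.RunParams) (n : ℕ), n ≤ p.K → Step.InInterval θ.γ n (gOfRecord₁₃ F N θ p) → ∀ m, m < n →
      θ.s2.cR * epsOfRecord θ.ν (gOfRecord₁₃ F N θ p) (m + 1) ≤ 2 * (θ.s2.cR * epsOfRecord θ.ν (gOfRecord₁₃ F N θ p) m))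
    (hBα : ∀ (p : B12.RunParams) (n : ℕ), n ≤ p.K → Step.InInterval θ.γ n (gOfRecord₁₃ F N θ p) → ∀ m, 1 ≤ m → m ≤ n →
      B₃ * (θ.s2.cR * epsOfRecord θ.ν (gOfRecord₁₃ F N θ p) m) ≤ (1 - θ.s2.βc) * (lfOfRecord₁₂ F N θ.toStage12Params).alpha0 (gOfRecord₁₃ F N θ p m))
    (htI : ∀ (p : B12.RunParams) (n : ℕ), n ≤ p.K → Step.InInterval θ.γ n (gOfRecord₁₃ F N θ p) → ∀ m, 1 ≤ m → m ≤ n →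
      B₃' * (θ.s2.cR * epsOfRecord θ.ν (gOfRecord₁₃ F N θ p) m) ≤ θ.s2.cB * (lfOfRecord₁₂ F N θ.toStage12Params).alpha0 (gOfRecord₁₃ F N θ p m))
    (htMS : ∀ (p : B12.RunParams) (n : ℕ), n ≤ p.K → Step.InInterval θ.γ n (gOfRecord₁₃ F N θ p) → ∀ m, 1 ≤ m → m ≤ n →
      B₃' * (θ.s2.cR * epsOfRecord θ.ν (gOfRecord₁₃ F N θ p) m) ≤ θ.s2.B * θ.s2.C * θ.s2.Mr * (lfOfRecord₁₂ F N θ.toStage12Params).alpha0 (gOfRecord₁₃ F N θ p m))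
    (hC1 : ∀ (p : B12.RunParams) (n : ℕ), n ≤ p.K → Step.InInterval θ.γ n (gOfRecord₁₃ F N θ p) → ∀ j, 1 ≤ j → j ≤ n →
      ∃ t : ℕ, 0 < t ∧ RkOfRecord (F.P p.K).L θ.ν.r (gOfRecord₁₃ F N θ p j) = (F.P p.K).L * t)
    (hsN : ∀ (p : B12.RunParams) (n : ℕ), n ≤ p.K → ∀ n', 1 ≤ n' → n' ≤ n + 1 →
      ((B14.Eq213MaximalDomains.side (F.P p.K).L θ.τ9.M n' : ℕ) : ℤ) < (F.P p.K).sitesPerDir 0) :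
    ∀ (p : B12.RunParams) (n : ℕ), n ≤ p.K → Step.InInterval θ.γ n (gOfRecord₁₃ F N θ p) → PartCompat₁₃ F N θ p n →
      ∀ s : SeqOfRecord F θ.ν θ.τ9.M (gOfRecord₁₃ F N θ p) p.K n, Sect2.SeqSeparated θ.ν.M₁ s → 0 < θ.ν.M₁ →
      Adm θ.ν θ.τ9.M (gOfRecord₁₃ F N θ p) p.K n s → ∀ W : MSField (F.P p.K) (SU N),
      Dat p.K s.Ω (suppDomOfRecord F θ.ν p.K s.Ω) n (fun j => θ.s2.cR * epsOfRecord θ.ν (gOfRecord₁₃ F N θ p) j) W →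
      ∀ j, 1 ≤ j → j ≤ n → ∀ X : (Sect2.domSys (F.P p.K) θ.τ9.M j).Dom,
      (Sect2.domSites (F.P p.K) θ.τ9.M j X ⊆ s.Λ j →
        Sect2.ofBackgroundC (settingOfRecord₁₃ F N θ p).ι (UbgMSCoPOfRecordB F N θ.ν θ.τ9.M (gOfRecord₁₃ F N θ p) p.K n s W) ∈
          Sect2.spaceI (settingOfRecord₁₃ F N θ p) (θ.Rz p.K) θ.τ9.M j (Sect2.domSites (F.P p.K) θ.τ9.M j X)
            ((settingOfRecord₁₃ F N θ p).lf.alpha0 ((settingOfRecord₁₃ F N θ p).flow.g j)) ((settingOfRecord₁₃ F N θ p).lf.alpha1 ((settingOfRecord₁₃ F N θ p).flow.g j))) ∧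
      (Sect2.admB (F.P p.K) θ.ν θ.τ9.M (gOfRecord₁₃ F N θ p) s.Ω s.Λ j (Sect2.domSites (F.P p.K) θ.τ9.M j X) = true →
        Sect2.ofBackgroundC (settingOfRecord₁₃ F N θ p).ι (UbgMSCoPOfRecordB F N θ.ν θ.τ9.M (gOfRecord₁₃ F N θ p) p.K n s W) ∈
          Sect2.spaceMS (settingOfRecord₁₃ F N θ p) (θ.Rz p.K) θ.τ9.M j (Sect2.domSites (F.P p.K) θ.τ9.M j X) s.Ω) :=
  Stage13Params.bgAtDatumBg_of_thm1RegSepCoP7MGB_of_thm1GaugeGB θ hθ hRz hM h15 h15G (fun p n s W => UbgMSCoPOfRecordB F N θ.ν θ.τ9.M (gOfRecord₁₃ F N θ p) p.K n s W)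
    (fun p n s W => ubgMSCoPOfRecordB_dichotomy θ.ν θ.τ9.M (gOfRecord₁₃ F N θ p) p.K n s W) hnum ha₀ hcomp hcomp' hBα htI htMS hC1 hsN

end LiftLam

end Literature.MathematicalPhysics.QuantumFieldTheory.Balaban1983to89.Node00

end
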